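import Literature.NumberTheory.EllipticCurves.IwasawaEisensteinTwistedRep
import Literature.NumberTheory.EllipticCurves.ZpExtensionDescentFixedPointFreeProofs
import HarnessLib

/-!
# Every class of `H¹(K_∞, M)[ψ_m]` is the tail coordinate of a class of `H¹(K, M ⊗ A_{m,k}(ψ⁻¹))`
# (surjectivity of `ι_{m,k}`, packaged; proofs only)

Topic `Literature/NumberTheory/EllipticCurves` (sequel to `IwasawaEisensteinTwistedRep`,
`ZpExtensionDescentFixedPointFreeProofs`, `IwasawaEisensteinTwistedCocycle{Readout,Injective}Proofs`,
`IwasawaAlgebraEisensteinTwistedInvariantsReadout`; cell `pub/bsd-print-x9`, blueprint HOME/p2/S1-DISCRETE-CONTROL §1(c),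
the SURJECTIVITY half for the Eisenstein-twisted module).  THEOREMS ONLY; no definition, no named fact, no instance,
no `sorry`.

Setting: `κ` a `ℤ_p`-extension of the number field `K` with topological generator `γ`; `χ : Γ_K →* A_{m,k}` trivial on
`N := ker κ` and on an open subgroup, with `χ(γ)(1+T) = 1` (the inverse Eisenstein twist `ψ⁻¹`); `M` a finite discrete
`Γ_K`-module killed by `p^k` with open stabilisers and `M^N = 0` (`M = E[p^k]`, `E(K_∞)[p] = 0`); `W := TwistedBy χ M`
(`= M ⊗ A_{m,k}(ψ⁻¹)`).  The TAIL READOUT `W → M`, `c ⊗ a ↦ λ_k(c) a`, is `N`-equivariant (`readout_id_smul`) and induces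
`H¹(K_∞, W) → H¹(K_∞, M)` (`resH1Hom (id) readout`).  **Theorem (`exists_readout_resSubgroup_eq`).** For every
`s ∈ H¹(K_∞, M)` with `((conj_γ − 1)^m + p) s = 0` there is `Y ∈ H¹(K, W)` whose restriction to `K_∞`, read by the tail form,
is `s`.  Proof: `w_j := (conj_γ − 1)^{m−1−j} s` satisfy `conj_γ w_j = w_j + w_{j−1}` (`j ≥ 1`), `conj_γ w_0 = w_0 − p w_{m−1}`;
for cocycle representatives `c_j` the `W`-valued cocycle `C(h) = Σ_i [T^i] ⊗ c_i(h)` on `N` has `conj_γ [C] = [C]` in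
`H¹(K_∞, W)` (coordinatewise the relations hold up to coboundaries `∂v_j`; `(1⊗γ) C(γ⁻¹hγ) − (1+T) C(h) = ∂(Σ [T^i] ⊗ v_i)(h)`,
and `χ(γ)(1+T) = 1` turns this into `γ·C(γ⁻¹hγ) − C(h) = ∂(χ(γ) Σ [T^i] ⊗ v_i)(h)`), so `[C]` descends to `Y ∈ H¹(K, W)` by
`ZpDescent.exists_resSubgroup_eq_of_conjH1_eq_of_forall_fixed_eq_zero` (the hypotheses for `W` are the `TwistedBy` lemmas),
and the tail of `C` is `c_{m−1}`, of class `w_{m−1} = s`.  With F2 (`psi_apply_…`) and F3-inj this is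
**`H¹(K, M ⊗ A_{m,k}(ψ⁻¹)) ≅ H¹(K_∞, M)[ψ_m]`**, Howard's «`H¹(K, A_𝔮) → H¹(K, 𝐀)[𝔮]`» (Prop. 2.2.8, second map) at
`𝔮 = T^m + p` before local conditions, at the finite level `p^k`.

References: [Howard2004HeegnerKolyvagin] Lemma 2.2.7, Prop. 2.2.8, proof of Thm. 2.2.10; [GreenbergLNM1716] §3 Lemma 3.2,
§4 pp. 98, 107; [SerreGaloisCohomology1997] I.§2.6 (b); [NeukirchSchmidtWingberg2008] I.§5–§6.  BSD is not proved by any of this.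
-/

noncomputable section

open CategoryTheory Literature.NumberTheory.EllipticCurves Literature.NumberTheory.GaloisRepresentations

universe u

namespace Literature.NumberTheory.EllipticCurves

namespace IwasawaAlgebra.EisensteinCoeff.TwistedBy

variable {K : Type u} [Field K] {p : ℕ} [hp : Fact p.Prime] (κ : ZpExtension K p)
variable {m : ℕ} (hm : 1 ≤ m) (k : ℕ)
variable {M : Type u} [AddCommGroup M] [DistribMulAction (Field.absoluteGaloisGroup K) M]
  [TopologicalSpace M] [DiscreteTopology M] (hM : ∀ x : M, (p ^ k) • x = 0)
  {χ : Field.absoluteGaloisGroup K →* EisensteinCoeff p m k} (hχker : ∀ σ ∈ κ.kerSubgroup, χ σ = 1)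

omit [TopologicalSpace M] [DiscreteTopology M] in
include hχker in
/-- **The tail readout `W → M` is `Gal(K̄/K_∞)`-equivariant** (`χ` is trivial there, and the readout commutes with
`1 ⊗ σ`): the compatibility hypothesis of `resH1Hom (id) readout`. [cite: GreenbergLNM1716, §4 p. 107] -/
theorem readout_id_smul (x : κ.kerSubgroup) (w : TwistedBy χ M) :
    ((EisensteinCoeff.Twisted.tailReadout p hm k hM).comp (ofTwisted χ M).symm.toAddMonoidHom)
        (ContinuousMonoidHom.id κ.kerSubgroup x • w) =
      x • ((EisensteinCoeff.Twisted.tailReadout p hm k hM).comp (ofTwisted χ M).symm.toAddMonoidHom) w := by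
  change EisensteinCoeff.Twisted.tailReadout p hm k hM ((ofTwisted χ M).symm ((x : Field.absoluteGaloisGroup K) • w)) =
    (x : Field.absoluteGaloisGroup K) • EisensteinCoeff.Twisted.tailReadout p hm k hM ((ofTwisted χ M).symm w)
  rw [ofTwisted_symm_smul_of_eq_one (hχker x x.2)]
  exact CoeffExtension.readout_mapEnd _ hM _ _

/-- **Surjectivity of `ι_{m,k}` onto `H¹(K_∞, M)[ψ_m]`** (module docstring): every `s ∈ H¹(K_∞, M)` with
`((conj_γ − 1)^m + p) s = 0` is the tail readout of the restriction to `K_∞` of a class `Y ∈ H¹(K, M ⊗ A_{m,k}(ψ⁻¹))`.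
[cite: Howard2004HeegnerKolyvagin, Lemma 2.2.7 / Prop. 2.2.8 and proof of Thm. 2.2.10 (𝔮 = T^m + p)]
[cite: GreenbergLNM1716, §3 Lemma 3.2 and §4 p. 107] [cite: SerreGaloisCohomology1997, I.§2.6 (b)] -/
theorem exists_readout_resSubgroup_eq [NumberField K] [Finite M] {γ : Field.absoluteGaloisGroup K}
    (hγ : κ.IsTopGenerator γ) (hχγ : χ γ * EisensteinCoeff.onePlusT p m k = 1)
    (U : Subgroup (Field.absoluteGaloisGroup K)) (hU : IsOpen (U : Set (Field.absoluteGaloisGroup K)))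
    (hχU : ∀ σ ∈ U, χ σ = 1)
    (hstab : ∀ a : M, IsOpen ((MulAction.stabilizer (Field.absoluteGaloisGroup K) a : Subgroup _) :
      Set (Field.absoluteGaloisGroup K)))
    (hfix : ∀ a : M, (∀ σ ∈ κ.kerSubgroup, σ • a = a) → a = 0)
    (θ : AddMonoid.End (subgroupH1 κ.kerSubgroup M)) (hθ : ∀ c, θ c = conjH1 κ.kerSubgroup M γ c)
    (s : subgroupH1 κ.kerSubgroup M) (hs : ((θ - 1) ^ m + (p : AddMonoid.End (subgroupH1 κ.kerSubgroup M))) s = 0) :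
    ∃ Y : discreteH1 (Field.absoluteGaloisGroup K) (TwistedBy χ M),
      resH1Hom (ContinuousMonoidHom.id κ.kerSubgroup)
          ((EisensteinCoeff.Twisted.tailReadout p hm k hM).comp (ofTwisted χ M).symm.toAddMonoidHom)
          (readout_id_smul κ hm k hM hχker)
        (ResKernel.resSubgroup κ.kerSubgroup (TwistedBy χ M) Y) = s := by
  classical
  -- abbreviations for the index bounds
  have hlast : m - 1 < m := Nat.sub_lt (lt_of_lt_of_le zero_lt_one hm) zero_lt_one
  -- (1) the coordinate classes `w_j = (θ - 1)^(m-1-j) s` and cocycle representatives `c_j`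
  let w : Fin m → subgroupH1 κ.kerSubgroup M := fun j ↦ ((θ - 1) ^ (m - 1 - (j : ℕ))) s
  have hwrec : ∀ j : Fin m, θ (w j) = w j + (if (j : ℕ) = 0 then -(p • w ⟨m - 1, hlast⟩)
      else w ⟨(j : ℕ) - 1, lt_of_le_of_lt (Nat.sub_le _ _) j.2⟩) := by
    intro j
    have hθw : θ (w j) = w j + ((θ - 1) ^ (m - 1 - (j : ℕ) + 1)) s := by
      show θ (((θ - 1) ^ (m - 1 - (j : ℕ))) s) = ((θ - 1) ^ (m - 1 - (j : ℕ))) s + ((θ - 1) ^ (m - 1 - (j : ℕ) + 1)) s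
      rw [pow_succ', show ∀ x, ((θ - 1) * (θ - 1) ^ (m - 1 - (j : ℕ))) x = (θ - 1) (((θ - 1) ^ (m - 1 - (j : ℕ))) x)
        from fun _ ↦ rfl, show ∀ x, (θ - 1) x = θ x - (1 : AddMonoid.End _) x from fun _ ↦ rfl,
        AddMonoid.End.one_apply, add_sub_cancel]
    rw [hθw]
    congr 1
    by_cases hj : (j : ℕ) = 0
    · rw [if_pos hj, hj, Nat.sub_zero, Nat.sub_add_cancel hm]
      have htop : w ⟨m - 1, hlast⟩ = s := by
        show ((θ - 1) ^ (m - 1 - (m - 1))) s = s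
        rw [Nat.sub_self, pow_zero, AddMonoid.End.one_apply]
      rw [htop, eq_neg_iff_add_eq_zero]
      have := hs
      rwa [show ∀ x, ((θ - 1) ^ m + (p : AddMonoid.End (subgroupH1 κ.kerSubgroup M))) x =
        ((θ - 1) ^ m) x + (p : AddMonoid.End _) x from fun _ ↦ rfl, AddMonoid.End.natCast_apply] at this
    · rw [if_neg hj]
      show ((θ - 1) ^ (m - 1 - (j : ℕ) + 1)) s = ((θ - 1) ^ (m - 1 - ((j : ℕ) - 1))) s
      have hidx : m - 1 - (j : ℕ) + 1 = m - 1 - ((j : ℕ) - 1) := by have := j.2; omega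
      rw [hidx]
  have hc : ∀ j : Fin m, ∃ c : contOneCocycles (discreteTopRep κ.kerSubgroup M), oneCocycleClass _ c = w j :=
    fun j ↦ oneCocycleClass_surjective _ (w j)
  choose c hcw using hc
  -- (2) the `W`-valued cocycle `C(h) = Σ [T^i] ⊗ c_i(h)` on `N`
  let Cfun : κ.kerSubgroup → TwistedBy χ M := fun h ↦ ofTwisted χ M (∑ i : Fin m, EisensteinCoeff.Twisted.tmul
    (Ideal.Quotient.mk _ ((PowerSeries.X : IwasawaAlgebra p) ^ (i : ℕ)) : EisensteinCoeff p m k) ((c i).1 h))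
  have hCcont : Continuous Cfun :=
    (continuous_of_discreteTopology (f := fun v : Fin m → M ↦ ofTwisted χ M (∑ i : Fin m, EisensteinCoeff.Twisted.tmul
      (Ideal.Quotient.mk _ ((PowerSeries.X : IwasawaAlgebra p) ^ (i : ℕ)) : EisensteinCoeff p m k) (v i)))).comp
      (continuous_pi fun i ↦ (c i).1.continuous)
  have hCsymm : ∀ h : κ.kerSubgroup, (ofTwisted χ M).symm (Cfun h) = ∑ i : Fin m, EisensteinCoeff.Twisted.tmul
      (Ideal.Quotient.mk _ ((PowerSeries.X : IwasawaAlgebra p) ^ (i : ℕ)) : EisensteinCoeff p m k) ((c i).1 h) :=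
    fun h ↦ AddEquiv.symm_apply_apply _ _
  -- `(1 ⊗ σ) (Σ [T^i] ⊗ a_i) = Σ [T^i] ⊗ σ a_i`
  have hmapsum : ∀ (σ : Field.absoluteGaloisGroup K) (a : Fin m → M),
      CoeffExtension.mapEnd (DistribMulAction.toAddMonoidEnd _ M σ) (∑ i : Fin m, EisensteinCoeff.Twisted.tmul
        (Ideal.Quotient.mk _ ((PowerSeries.X : IwasawaAlgebra p) ^ (i : ℕ)) : EisensteinCoeff p m k) (a i)) =
      ∑ i : Fin m, EisensteinCoeff.Twisted.tmul
        (Ideal.Quotient.mk _ ((PowerSeries.X : IwasawaAlgebra p) ^ (i : ℕ)) : EisensteinCoeff p m k) (σ • a i) := by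
    intro σ a
    rw [map_sum]
    exact Finset.sum_congr rfl fun i _ ↦ CoeffExtension.mapEnd_tmul _ _ _
  have hCcoc : ∀ g h : κ.kerSubgroup, Cfun (g * h) = Cfun g + g • Cfun h := by
    intro g h
    apply (ofTwisted χ M).symm.injective
    rw [map_add, hCsymm, hCsymm, Subgroup.smul_def, ofTwisted_symm_smul_of_eq_one (hχker g g.2), hCsymm, hmapsum,
      ← Finset.sum_add_distrib]
    refine Finset.sum_congr rfl fun i _ ↦ ?_
    rw [(c i).2 g h, EisensteinCoeff.Twisted.tmul_add]
    rfl
  let C : contOneCocycles (discreteTopRep κ.kerSubgroup (TwistedBy χ M)) := ⟨⟨Cfun, hCcont⟩, hCcoc⟩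
  have hC1 : ∀ h : κ.kerSubgroup, C.1 h = Cfun h := fun _ ↦ rfl
  -- (3) `conj_γ [C] = [C]`
  -- (3a) the coordinate relations up to coboundaries: `γ c_j(γ⁻¹ h γ) - c_j h - shift_j h = h v_j - v_j`
  have hcM : ∀ (x : κ.kerSubgroup) (a : M), DistribSMul.toAddMonoidHom M γ (subgroupConj κ.kerSubgroup γ x • a) =
      x • DistribSMul.toAddMonoidHom M γ a := fun x a ↦ by
    simp only [DistribSMul.toAddMonoidHom_apply, Subgroup.smul_def, subgroupConj_apply_coe,
      smul_smul, mul_assoc, mul_inv_cancel_left]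
  have hv : ∀ j : Fin m, ∃ v : M, ∀ h : κ.kerSubgroup,
      γ • (c j).1 ⟨γ⁻¹ * h * γ, by simpa using Subgroup.Normal.conj_mem inferInstance (h : Field.absoluteGaloisGroup K) h.2 γ⁻¹⟩ -
        (c j).1 h - (if (j : ℕ) = 0 then -(p • (c ⟨m - 1, hlast⟩).1 h)
          else (c ⟨(j : ℕ) - 1, lt_of_le_of_lt (Nat.sub_le _ _) j.2⟩).1 h) =
        (h : Field.absoluteGaloisGroup K) • v - v := by
    intro j
    -- the pulled-back cocycle `h ↦ γ c_j(γ⁻¹ h γ)` represents `conj_γ w_j`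
    set ψj := contOneCocycles.pullback (subgroupConj κ.kerSubgroup γ)
      (resHomOfEquivariant (subgroupConj κ.kerSubgroup γ) (DistribSMul.toAddMonoidHom M γ) hcM) (c j) with hψj
    have hψjcls : conjH1 κ.kerSubgroup M γ (oneCocycleClass _ (c j)) = oneCocycleClass _ ψj :=
      map_oneCocycleClass _ _ _ (c j)
    have hψjapp : ∀ h : κ.kerSubgroup, ψj.1 h = γ • (c j).1 ⟨γ⁻¹ * h * γ, by
        simpa using Subgroup.Normal.conj_mem inferInstance (h : Field.absoluteGaloisGroup K) h.2 γ⁻¹⟩ := fun h ↦ by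
      rw [hψj, contOneCocycles.pullback_apply]
      rfl
    -- the shift cocycle and the class identity
    let Sj : contOneCocycles (discreteTopRep κ.kerSubgroup M) :=
      if (j : ℕ) = 0 then -(p • c ⟨m - 1, hlast⟩) else c ⟨(j : ℕ) - 1, lt_of_le_of_lt (Nat.sub_le _ _) j.2⟩
    have hSjcls : oneCocycleClass _ Sj = (if (j : ℕ) = 0 then -(p • w ⟨m - 1, hlast⟩)
        else w ⟨(j : ℕ) - 1, lt_of_le_of_lt (Nat.sub_le _ _) j.2⟩) := by
      by_cases hj : (j : ℕ) = 0
      · simp only [Sj, if_pos hj]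
        rw [← hcw]
        show oneCocycleClassₗ (discreteTopRep κ.kerSubgroup M) (-(p • c ⟨m - 1, hlast⟩)) =
          -(p • oneCocycleClassₗ (discreteTopRep κ.kerSubgroup M) (c ⟨m - 1, hlast⟩))
        rw [map_neg, map_nsmul]
      · simp only [Sj, if_neg hj]
        exact hcw _
    have hSjapp : ∀ h : κ.kerSubgroup, Sj.1 h = (if (j : ℕ) = 0 then -(p • (c ⟨m - 1, hlast⟩).1 h)
        else (c ⟨(j : ℕ) - 1, lt_of_le_of_lt (Nat.sub_le _ _) j.2⟩).1 h) := fun h ↦ by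
      by_cases hj : (j : ℕ) = 0
      · simp only [Sj, if_pos hj]; rfl
      · simp only [Sj, if_neg hj]
    have hzero : oneCocycleClass _ (ψj - c j - Sj) = 0 := by
      rw [oneCocycleClass_sub, oneCocycleClass_sub, ← hψjcls, hcw, hSjcls, ← hθ, hwrec j, add_sub_cancel_left, sub_self]
    obtain ⟨v, hvv⟩ := (oneCocycleClass_eq_zero_iff _ _).mp hzero
    refine ⟨v, fun h ↦ ?_⟩
    have := hvv h
    rw [Submodule.coe_sub, Submodule.coe_sub, ContinuousMap.sub_apply, ContinuousMap.sub_apply, hψjapp, hSjapp] at this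
    exact this
  choose v hvv using hv
  -- (3b) the `W`-level identity `(1⊗γ) C(γ⁻¹hγ) - (1+T) C(h) = (1⊗h) w' - w'`, `w' = Σ [T^i] ⊗ v_i`
  set w' : EisensteinCoeff.Twisted p m k M := ∑ i : Fin m, EisensteinCoeff.Twisted.tmul
    (Ideal.Quotient.mk _ ((PowerSeries.X : IwasawaAlgebra p) ^ (i : ℕ)) : EisensteinCoeff p m k) (v i) with hw'
  have hconjmem : ∀ h : κ.kerSubgroup, (γ⁻¹ * h * γ : Field.absoluteGaloisGroup K) ∈ κ.kerSubgroup := fun h ↦ by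
    simpa using Subgroup.Normal.conj_mem inferInstance (h : Field.absoluteGaloisGroup K) h.2 γ⁻¹
  have hWid : ∀ h : κ.kerSubgroup,
      CoeffExtension.mapEnd (DistribMulAction.toAddMonoidEnd _ M γ) ((ofTwisted χ M).symm (Cfun ⟨γ⁻¹ * h * γ, hconjmem h⟩)) -
        EisensteinCoeff.onePlusT p m k • (ofTwisted χ M).symm (Cfun h) =
      CoeffExtension.mapEnd (DistribMulAction.toAddMonoidEnd _ M (h : Field.absoluteGaloisGroup K)) w' - w' := by
    intro h
    rw [← sub_eq_zero]
    refine EisensteinCoeff.Twisted.eq_zero_of_forall_tailReadout_dualFamily_smul_eq_zero p hm k hM _ fun j ↦ ?_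
    rw [smul_sub, map_sub, smul_sub, map_sub, IwasawaDual.tailReadout_dualFamily_smul_mapEnd (hm := hm) (hM := hM),
      hCsymm, hCsymm, EisensteinCoeff.Twisted.tailReadout_dualFamily_smul_sum,
      IwasawaDual.tailReadout_dualFamily_smul_onePlusT_smul (hm := hm) (hM := hM),
      EisensteinCoeff.Twisted.tailReadout_dualFamily_smul_sum,
      EisensteinCoeff.Twisted.tailReadout_dualFamily_smul_X_smul_sum, hw',
      IwasawaDual.tailReadout_dualFamily_smul_mapEnd_sum_sub (hm := hm) (hM := hM), ← hvv j h, sub_eq_zero,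
      sub_add_eq_sub_sub]
  -- (3c) the coboundary for `conj_γ C - C`
  have hcW : ∀ (x : κ.kerSubgroup) (a : TwistedBy χ M),
      DistribSMul.toAddMonoidHom (TwistedBy χ M) γ (subgroupConj κ.kerSubgroup γ x • a) =
        x • DistribSMul.toAddMonoidHom (TwistedBy χ M) γ a := fun x a ↦ by
    simp only [DistribSMul.toAddMonoidHom_apply, Subgroup.smul_def, subgroupConj_apply_coe,
      smul_smul, mul_assoc, mul_inv_cancel_left]
  set ψC := contOneCocycles.pullback (subgroupConj κ.kerSubgroup γ)
    (resHomOfEquivariant (subgroupConj κ.kerSubgroup γ) (DistribSMul.toAddMonoidHom (TwistedBy χ M) γ) hcW) C with hψC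
  have hkeyC : conjH1 κ.kerSubgroup (TwistedBy χ M) γ (oneCocycleClass _ C) = oneCocycleClass _ ψC :=
    map_oneCocycleClass _ _ _ C
  have hψCapp : ∀ h : κ.kerSubgroup, ψC.1 h = γ • Cfun ⟨γ⁻¹ * h * γ, hconjmem h⟩ := fun h ↦ by
    rw [hψC, contOneCocycles.pullback_apply]
    rfl
  have hinv : conjH1 κ.kerSubgroup (TwistedBy χ M) γ (oneCocycleClass _ C) = oneCocycleClass _ C := by
    rw [hkeyC, ← sub_eq_zero, ← oneCocycleClass_sub, oneCocycleClass_eq_zero_iff]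
    refine ⟨ofTwisted χ M (χ γ • w'), fun h ↦ ?_⟩
    change ψC.1 h - C.1 h = (h : Field.absoluteGaloisGroup K) • ofTwisted χ M (χ γ • w') - ofTwisted χ M (χ γ • w')
    rw [hψCapp, hC1]
    apply (ofTwisted χ M).symm.injective
    have e1 : (ofTwisted χ M).symm ((h : Field.absoluteGaloisGroup K) • ofTwisted χ M (χ γ • w')) =
        χ γ • CoeffExtension.mapEnd (DistribMulAction.toAddMonoidEnd _ M (h : Field.absoluteGaloisGroup K)) w' := by
      rw [ofTwisted_symm_smul_of_eq_one (hχker h h.2), AddEquiv.symm_apply_apply, LinearMap.map_smul]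
    have e2 : (ofTwisted χ M).symm (γ • Cfun ⟨γ⁻¹ * h * γ, hconjmem h⟩) =
        χ γ • CoeffExtension.mapEnd (DistribMulAction.toAddMonoidEnd _ M γ)
          ((ofTwisted χ M).symm (Cfun ⟨γ⁻¹ * h * γ, hconjmem h⟩)) := ofTwisted_symm_smul χ γ _
    have e3 : (ofTwisted χ M).symm (ofTwisted χ M (χ γ • w')) = χ γ • w' := AddEquiv.symm_apply_apply _ _
    rw [map_sub, map_sub, e1, e3, e2, ← smul_sub, ← hWid h, smul_sub, smul_smul, hχγ, one_smul]
  -- (4) descent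
  haveI : Finite (TwistedBy χ M) := TwistedBy.finite hm
  obtain ⟨Y, hY⟩ := ZpDescent.exists_resSubgroup_eq_of_conjH1_eq_of_forall_fixed_eq_zero (κ := κ)
    (M := TwistedBy χ M) hγ (TwistedBy.isOpen_stabilizer U hU hχU hstab)
    (TwistedBy.eq_zero_of_forall_smul_eq hm hM κ.kerSubgroup hχker hfix) (oneCocycleClass _ C) hinv
  refine ⟨Y, ?_⟩
  rw [hY]
  -- (5) the tail readout of `[C]` is `[c_{m-1}] = w_{m-1} = s`
  have hread : resH1Hom (ContinuousMonoidHom.id κ.kerSubgroup)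
      ((EisensteinCoeff.Twisted.tailReadout p hm k hM).comp (ofTwisted χ M).symm.toAddMonoidHom)
      (readout_id_smul κ hm k hM hχker) (oneCocycleClass _ C) =
      oneCocycleClass _ (contOneCocycles.pullback (ContinuousMonoidHom.id κ.kerSubgroup)
        (resHomOfEquivariant (ContinuousMonoidHom.id κ.kerSubgroup)
          ((EisensteinCoeff.Twisted.tailReadout p hm k hM).comp (ofTwisted χ M).symm.toAddMonoidHom)
          (readout_id_smul κ hm k hM hχker)) C) :=
    map_oneCocycleClass _ _ _ C
  have hpull : contOneCocycles.pullback (ContinuousMonoidHom.id κ.kerSubgroup)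
      (resHomOfEquivariant (ContinuousMonoidHom.id κ.kerSubgroup)
        ((EisensteinCoeff.Twisted.tailReadout p hm k hM).comp (ofTwisted χ M).symm.toAddMonoidHom)
        (readout_id_smul κ hm k hM hχker)) C = c ⟨m - 1, hlast⟩ := by
    apply Subtype.ext
    ext h
    rw [contOneCocycles.pullback_apply]
    change EisensteinCoeff.Twisted.tailReadout p hm k hM ((ofTwisted χ M).symm (Cfun h)) = (c ⟨m - 1, hlast⟩).1 h
    rw [hCsymm, EisensteinCoeff.Twisted.tailReadout_sum]
  rw [hread, hpull, hcw]
  show ((θ - 1) ^ (m - 1 - (m - 1))) s = s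
  rw [Nat.sub_self, pow_zero, AddMonoid.End.one_apply]

end IwasawaAlgebra.EisensteinCoeff.TwistedBy

end Literature.NumberTheory.EllipticCurves
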